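import Summits.KontsevichZagierPeriods.KontsevichZagierPeriods.Theorems.TerasomaMultiplicationBetaCancellationSideDescent
import Summits.KontsevichZagierPeriods.KontsevichZagierPeriods.Theorems.TerasomaMultiplicationBetaCancellationStubSideMirror
import Summits.KontsevichZagierPeriods.KontsevichZagierPeriods.Theorems.TerasomaMultiplicationBetaCancellationStubSideFinishBand
import Summits.KontsevichZagierPeriods.KontsevichZagierPeriods.Theorems.TerasomaMultiplicationBetaCancellationStubSideFinishQuarter

/-!
# Side descent: the finishing side sets, and the crux as "side reduction"

Instances of the master theorem `sideDescent` (`…SideDescent.lean`; crux lead seat c8, `--supports`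
stmt-KontsevichZagierPeriods-13633, line `dirichlet-companion-to-pi`). A side set `S ⊆ ℝ` FINISHES when
`[D ∩ {x ∈ S}]·c ∈ relations` together with `[π]·c ∈ relations` forces `c ∈ relations`; this is
decided by the trace of `S` on `[-1,1]` (outside the disc `S` is free). Proved here for the traces

* `(-∞,-1/2)` — the segment `S_A`: one-segment descent (Archimedes' trisection, seat c7);
* `(1/2,∞)` — the mirror segment, by the reflection `x ↦ -x` (`stub_sideMirror`, p120424);
* `(-1/2,1/2)` — the central band: `[D] = [S_A] + [band] + [S_E]`, `[S_E] ∼ [S_A]`, torsion-freeness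
  (`stub_sideFinishBand`, p120523);
* `(-1/2,0)` — the left quarter band: halves by the mirror, `[S_A] = [D ∩ {x<0}] − [quarter]`
  (`stub_sideFinishQuarter`, p120560);
* `(0,1/2)` — the right quarter band, by the mirror again.

(The list of finishing traces is, up to null sets, exactly the unions of the four arcs cut out by
`x ∈ {-1/2, 0, 1/2}` with non-zero constant term — by Baker's theorem and Niven's theorem no other
rational chord has a segment of area in `ℚ̄ + ℚ̄π`; the remaining unions are finite sums of the cases
here and are not spelled out.) Hence FIVE incomparable classes of certificates (times the freedom of
`S` outside `[-1,1]`) for which `π`-cancellation (item 0540) is now a theorem: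
`side_ayoubPiCancellation_Iio/Ioi/band/quarterL/quarterR`. For `S = (-∞,-1/2)` the class is the
largest so far (it contains the wall-respecting class), and the crux is EQUIVALENT to **side
reduction** at `S_A` — see `…SideReduction.lean` (`betaCancellation_iff_sideReduction`,
`wallClosure_le_sideClosure_Iio`): the open core after seat c8 (≡ item 0540).
-/

noncomputable section

-- `Summit.KontsevichZagierPeriods.KontsevichZagierPeriods.…` is the tree's mandated layout (single-conjunct summit).
set_option linter.dupNamespace false

namespace Summit.KontsevichZagierPeriods.KontsevichZagierPeriods.BetaCancellationLine

open Set
open Literature.NumberTheory.Transcendental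
open Literature.NumberTheory.Transcendental.KZ

/-! ### Semialgebraic half-cylinders over rational thresholds -/

/-- `{z | z 0 < q}` is `ℚ`-semialgebraic (`q` rational) in every dimension `≥ 1`. [folklore] -/
theorem isSemialgebraic_setOf_apply_zero_lt_ratCast (k : ℕ) (q : ℚ) :
    Literature.ModelTheory.ExponentialFields.IsSemialgebraic ℚ
      {z : Fin (k + 1) → ℝ | z 0 < (q : ℝ)} := by
  have h := Literature.ModelTheory.ExponentialFields.isSemialgebraic_setOf_eval_lt
    (k := ℚ) (R := ℝ) (MvPolynomial.X (0 : Fin (k + 1))) (MvPolynomial.C q)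
  have e : {z : Fin (k + 1) → ℝ | z 0 < (q : ℝ)} =
      {x : Fin (k + 1) → ℝ | MvPolynomial.aeval x (MvPolynomial.X (0 : Fin (k + 1)) : MvPolynomial (Fin (k + 1)) ℚ) <
        MvPolynomial.aeval x (MvPolynomial.C q : MvPolynomial (Fin (k + 1)) ℚ)} := by
    ext z
    simp only [mem_setOf_eq, MvPolynomial.aeval_X, MvPolynomial.aeval_C, eq_ratCast]
  rw [e]
  exact h

/-- `{z | q < z 0}` is `ℚ`-semialgebraic (`q` rational) in every dimension `≥ 1`. [folklore] -/
theorem isSemialgebraic_setOf_ratCast_lt_apply_zero (k : ℕ) (q : ℚ) :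
    Literature.ModelTheory.ExponentialFields.IsSemialgebraic ℚ
      {z : Fin (k + 1) → ℝ | (q : ℝ) < z 0} := by
  have h := Literature.ModelTheory.ExponentialFields.isSemialgebraic_setOf_eval_lt
    (k := ℚ) (R := ℝ) (MvPolynomial.C q) (MvPolynomial.X (0 : Fin (k + 1)))
  have e : {z : Fin (k + 1) → ℝ | (q : ℝ) < z 0} =
      {x : Fin (k + 1) → ℝ | MvPolynomial.aeval x (MvPolynomial.C q : MvPolynomial (Fin (k + 1)) ℚ) <
        MvPolynomial.aeval x (MvPolynomial.X (0 : Fin (k + 1)) : MvPolynomial (Fin (k + 1)) ℚ)} := by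
    ext z
    simp only [mem_setOf_eq, MvPolynomial.aeval_X, MvPolynomial.aeval_C, eq_ratCast]
  rw [e]
  exact h

/-- The half-cylinder over `(1/2, ∞)` is `ℚ`-semialgebraic. [folklore] -/
theorem isSemialgebraic_setOf_apply_zero_mem_Ioi_half (k : ℕ) :
    Literature.ModelTheory.ExponentialFields.IsSemialgebraic ℚ
      {z : Fin (k + 1) → ℝ | z 0 ∈ Set.Ioi (1/2 : ℝ)} := by
  have h := isSemialgebraic_setOf_ratCast_lt_apply_zero k (1/2)
  have e : {z : Fin (k + 1) → ℝ | z 0 ∈ Set.Ioi (1/2 : ℝ)} = {z : Fin (k + 1) → ℝ | ((1/2 : ℚ) : ℝ) < z 0} := by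
    ext z
    simp only [mem_setOf_eq, mem_Ioi]
    push_cast
    exact Iff.rfl
  rw [e]
  exact h

/-- The cylinder over a rational open interval `(a, b)` is `ℚ`-semialgebraic. [folklore] -/
theorem isSemialgebraic_setOf_apply_zero_mem_Ioo_ratCast (k : ℕ) (a b : ℚ) :
    Literature.ModelTheory.ExponentialFields.IsSemialgebraic ℚ
      {z : Fin (k + 1) → ℝ | z 0 ∈ Set.Ioo (a : ℝ) b} := by
  have e : {z : Fin (k + 1) → ℝ | z 0 ∈ Set.Ioo (a : ℝ) b} =
      {z : Fin (k + 1) → ℝ | (a : ℝ) < z 0} ∩ {z : Fin (k + 1) → ℝ | z 0 < (b : ℝ)} := by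
    ext z
    simp only [mem_setOf_eq, mem_Ioo, mem_inter_iff]
  rw [e]
  exact (isSemialgebraic_setOf_ratCast_lt_apply_zero k a).inter
    (isSemialgebraic_setOf_apply_zero_lt_ratCast k b)

/-- The cylinder over the central band `(-1/2, 1/2)` is `ℚ`-semialgebraic. [folklore] -/
theorem isSemialgebraic_setOf_apply_zero_mem_band (k : ℕ) :
    Literature.ModelTheory.ExponentialFields.IsSemialgebraic ℚ
      {z : Fin (k + 1) → ℝ | z 0 ∈ Set.Ioo (-1/2 : ℝ) (1/2)} := by
  have h := isSemialgebraic_setOf_apply_zero_mem_Ioo_ratCast k (-1/2) (1/2)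
  push_cast at h
  exact h

/-- The cylinder over the left quarter band `(-1/2, 0)` is `ℚ`-semialgebraic. [folklore] -/
theorem isSemialgebraic_setOf_apply_zero_mem_quarterL (k : ℕ) :
    Literature.ModelTheory.ExponentialFields.IsSemialgebraic ℚ
      {z : Fin (k + 1) → ℝ | z 0 ∈ Set.Ioo (-1/2 : ℝ) 0} := by
  have h := isSemialgebraic_setOf_apply_zero_mem_Ioo_ratCast k (-1/2) 0
  push_cast at h
  exact h

/-- The cylinder over the right quarter band `(0, 1/2)` is `ℚ`-semialgebraic. [folklore] -/
theorem isSemialgebraic_setOf_apply_zero_mem_quarterR (k : ℕ) :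
    Literature.ModelTheory.ExponentialFields.IsSemialgebraic ℚ
      {z : Fin (k + 1) → ℝ | z 0 ∈ Set.Ioo (0 : ℝ) (1/2)} := by
  have h := isSemialgebraic_setOf_apply_zero_mem_Ioo_ratCast k 0 (1/2)
  push_cast at h
  exact h

/-! ### The finishing disc pieces -/

/-- **The segment `S_A` finishes** (one-segment descent, seat c7): `[S_A]·c ∈ relations` and
`[π]·c ∈ relations` give `[D ∩ {x > -1/2}]·c ∈ relations` (cut at the null chord) and then
`c ∈ relations` by Archimedes' trisection. [folklore] -/
theorem finish_segA (c : FormalRep) (hA : of (piRep.slabRestrict (-2) (-1/2)) * c ∈ relations)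
    (hπ : of piRep * c ∈ relations) : c ∈ relations := by
  have hX := mul_mem_relations_right_holds _ c of_piRep_sub_of_slabs_mem_relations
  have hD : of (piRep.slabRestrict (-1/2) 2) * c ∈ relations := by
    have e : of (piRep.slabRestrict (-1/2) 2) * c =
        of piRep * c - of (piRep.slabRestrict (-2) (-1/2)) * c -
          (of piRep - of (piRep.slabRestrict (-2) (-1/2)) - of (piRep.slabRestrict (-1/2) 2)) * c := by
      simp only [sub_mul]; abel
    rw [e]
    exact relations.sub_mem (relations.sub_mem hπ hA) hX
  exact stub_archimedesOfTriangle stub_triangleConst c hA hD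

/-- The domain of `S_A = [π]|{-2 < x < -1/2}` is the disc piece over `(-∞, -1/2)` (the disc pins
`-1 ≤ x`). [folklore] -/
theorem segA_domain_eq_side :
    (piRep.slabRestrict (-2) (-1/2)).domain = piDisc ∩ {z | z 0 ∈ Set.Iio (-1/2 : ℝ)} := by
  ext z
  simp only [IntegralRep.domain_slabRestrict, piRep_domain, mem_inter_iff, mem_paramSlab,
    mem_setOf_eq, mem_Iio]
  push_cast
  constructor
  · rintro ⟨hd, -, h⟩
    exact ⟨hd, h⟩
  · rintro ⟨hd, h⟩
    have hd' : z 0 ^ 2 + z 1 ^ 2 ≤ 1 := hd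
    exact ⟨hd, by nlinarith [sq_nonneg (z 1), sq_nonneg (z 0 + 1)], h⟩

/-- The domain of the mirror segment `S_E = ([π]|{-1/2<x<2})|{1/2<x<2}` is the disc piece over
`(1/2, ∞)`. [folklore] -/
theorem segE_domain_eq_side :
    ((piRep.slabRestrict (-1/2) 2).slabRestrict (1/2) 2).domain = piDisc ∩ {z | z 0 ∈ Set.Ioi (1/2 : ℝ)} := by
  rw [sideBand_domain_segE]
  ext z
  simp only [mem_inter_iff, mem_piDisc, mem_setOf_eq, mem_Ioo, mem_Ioi]
  push_cast
  constructor
  · rintro ⟨hd, -, h⟩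
    exact ⟨hd, by linarith⟩
  · rintro ⟨hd, h⟩
    exact ⟨hd, by nlinarith [sq_nonneg (z 1), sq_nonneg (z 0 - 1)], by linarith⟩

/-- **The mirror segment `S_E` finishes**: `[S_A] − [S_E] ∈ relations` by the reflection `x ↦ -x`
(`stub_sideMirror`), then `finish_segA`. [folklore] -/
theorem finish_segE (c : FormalRep)
    (hE : of ((piRep.slabRestrict (-1/2) 2).slabRestrict (1/2) 2) * c ∈ relations)
    (hπ : of piRep * c ∈ relations) : c ∈ relations := by
  have hM := stub_sideMirror (Set.Ioo ((-2 : ℚ) : ℝ) ((-1/2 : ℚ) : ℝ)) (piRep.slabRestrict (-2) (-1/2))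
    ((piRep.slabRestrict (-1/2) 2).slabRestrict (1/2) 2) rfl sideBand_domain_segE rfl rfl
  have hX := mul_mem_relations_right_holds _ c hM
  have hA : of (piRep.slabRestrict (-2) (-1/2)) * c ∈ relations := by
    have e : of (piRep.slabRestrict (-2) (-1/2)) * c =
        (of (piRep.slabRestrict (-2) (-1/2)) - of ((piRep.slabRestrict (-1/2) 2).slabRestrict (1/2) 2)) * c +
          of ((piRep.slabRestrict (-1/2) 2).slabRestrict (1/2) 2) * c := by
      simp only [sub_mul]; abel
    rw [e]
    exact relations.add_mem hX hE
  exact finish_segA c hA hπ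

/-- The left quarter-band piece, as a set, is the mirror image of the right quarter-band piece.
[folklore] -/
theorem quarterL_eq_mirror_quarterR :
    piDisc ∩ {z : Fin 2 → ℝ | z 0 ∈ Set.Ioo (-1/2 : ℝ) 0} = piDisc ∩ {z | -z 0 ∈ Set.Ioo (0 : ℝ) (1/2)} := by
  ext z
  simp only [mem_inter_iff, mem_setOf_eq, mem_Ioo]
  constructor
  · rintro ⟨hd, h1, h2⟩
    exact ⟨hd, by linarith, by linarith⟩
  · rintro ⟨hd, h1, h2⟩
    exact ⟨hd, by linarith, by linarith⟩

/-- **The right quarter band finishes**: mirror it onto the left quarter band (`stub_sideMirror`) and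
apply `stub_sideFinishQuarter`. [folklore] -/
theorem finish_quarterR {DR DL : IntegralRep 2}
    (hDR : DR.domain = piDisc ∩ {z | z 0 ∈ Set.Ioo (0 : ℝ) (1/2)}) (hDR1 : DR.integrand = fun _ => 1)
    (hDL : DL.domain = piDisc ∩ {z | z 0 ∈ Set.Ioo (-1/2 : ℝ) 0}) (hDL1 : DL.integrand = fun _ => 1)
    (c : FormalRep) (hR : of DR * c ∈ relations) (hπ : of piRep * c ∈ relations) : c ∈ relations := by
  have hM := stub_sideMirror (Set.Ioo (0 : ℝ) (1/2)) DR DL hDR (hDL.trans quarterL_eq_mirror_quarterR)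
    hDR1 hDL1
  have hX := mul_mem_relations_right_holds _ c hM
  have hL : of DL * c ∈ relations := by
    have e : of DL * c = of DR * c - (of DR - of DL) * c := by
      simp only [sub_mul]; abel
    rw [e]
    exact relations.sub_mem hR hX
  exact stub_sideFinishQuarter stub_sideMirror DL hDL hDL1 c hL hπ

/-! ### `π`-cancellation for the five classes of side-respecting certificates -/

/-- **`π`-cancellation for certificates respecting the half-line `(-∞, -1/2)`** (substitutions with
`Φ x 0 < -1/2 ↔ x 0 < -1/2`; the largest class so far). [folklore] -/
theorem side_ayoubPiCancellation_Iio :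
    ∀ (P : ∀ n : ℕ, IntegralRep n → IntegralRep (n + 2)),
      (∀ (n : ℕ) (r : IntegralRep n), (P n r).domain = {z : Fin (n + 2) → ℝ | z 0 ^ 2 + z 1 ^ 2 ≤ 1 ∧ (fun i : Fin n => z i.succ.succ) ∈ r.domain} ∧ (P n r).integrand = fun z => r.integrand (fun i : Fin n => z i.succ.succ)) →
      ∀ c : FormalRep,
        FreeAbelianGroup.lift (fun s : (Σ n, IntegralRep n) => of (P s.1 s.2)) c ∈
          AddSubgroup.closure (domainAddRel ∪ integrandAddRel ∪
          {x | ∃ (n : ℕ) (r r' : IntegralRep (n + 1)) (Φ : (Fin (n + 1) → ℝ) → (Fin (n + 1) → ℝ))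
              (Φ' : (Fin (n + 1) → ℝ) → (Fin (n + 1) → ℝ) →L[ℝ] (Fin (n + 1) → ℝ)),
            IsSemialgebraicMapOn ℚ r.domain Φ ∧
            (∀ x ∈ r.domain, HasFDerivWithinAt Φ (Φ' x) r.domain x) ∧ Set.InjOn Φ r.domain ∧
            r'.domain = Φ '' r.domain ∧
            (∀ x ∈ r.domain, r.integrand x = r'.integrand (Φ x) * |(Φ' x).det|) ∧
            (∀ x ∈ r.domain, Φ x 0 ∈ Set.Iio (-1/2 : ℝ) ↔ x 0 ∈ Set.Iio (-1/2 : ℝ)) ∧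
            x = of r - of r'} ∪
          fibredNewtonLeibnizRel) →
        c ∈ relations :=
  sideDescent (Set.Iio (-1/2 : ℝ)) wallRestrict_isSemialgebraic_Iio segA_domain_eq_side rfl finish_segA

/-- **`π`-cancellation for certificates respecting the half-line `(1/2, ∞)`.** [folklore] -/
theorem side_ayoubPiCancellation_Ioi :
    ∀ (P : ∀ n : ℕ, IntegralRep n → IntegralRep (n + 2)),
      (∀ (n : ℕ) (r : IntegralRep n), (P n r).domain = {z : Fin (n + 2) → ℝ | z 0 ^ 2 + z 1 ^ 2 ≤ 1 ∧ (fun i : Fin n => z i.succ.succ) ∈ r.domain} ∧ (P n r).integrand = fun z => r.integrand (fun i : Fin n => z i.succ.succ)) →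
      ∀ c : FormalRep,
        FreeAbelianGroup.lift (fun s : (Σ n, IntegralRep n) => of (P s.1 s.2)) c ∈
          AddSubgroup.closure (domainAddRel ∪ integrandAddRel ∪
          {x | ∃ (n : ℕ) (r r' : IntegralRep (n + 1)) (Φ : (Fin (n + 1) → ℝ) → (Fin (n + 1) → ℝ))
              (Φ' : (Fin (n + 1) → ℝ) → (Fin (n + 1) → ℝ) →L[ℝ] (Fin (n + 1) → ℝ)),
            IsSemialgebraicMapOn ℚ r.domain Φ ∧
            (∀ x ∈ r.domain, HasFDerivWithinAt Φ (Φ' x) r.domain x) ∧ Set.InjOn Φ r.domain ∧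
            r'.domain = Φ '' r.domain ∧
            (∀ x ∈ r.domain, r.integrand x = r'.integrand (Φ x) * |(Φ' x).det|) ∧
            (∀ x ∈ r.domain, Φ x 0 ∈ Set.Ioi (1/2 : ℝ) ↔ x 0 ∈ Set.Ioi (1/2 : ℝ)) ∧
            x = of r - of r'} ∪
          fibredNewtonLeibnizRel) →
        c ∈ relations :=
  sideDescent (Set.Ioi (1/2 : ℝ)) isSemialgebraic_setOf_apply_zero_mem_Ioi_half segE_domain_eq_side rfl
    finish_segE

/-- **`π`-cancellation for certificates respecting the central band `(-1/2, 1/2)`** (substitutions may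
swap the two caps `x < -1/2`, `x > 1/2`). [folklore] -/
theorem side_ayoubPiCancellation_band :
    ∀ (P : ∀ n : ℕ, IntegralRep n → IntegralRep (n + 2)),
      (∀ (n : ℕ) (r : IntegralRep n), (P n r).domain = {z : Fin (n + 2) → ℝ | z 0 ^ 2 + z 1 ^ 2 ≤ 1 ∧ (fun i : Fin n => z i.succ.succ) ∈ r.domain} ∧ (P n r).integrand = fun z => r.integrand (fun i : Fin n => z i.succ.succ)) →
      ∀ c : FormalRep,
        FreeAbelianGroup.lift (fun s : (Σ n, IntegralRep n) => of (P s.1 s.2)) c ∈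
          AddSubgroup.closure (domainAddRel ∪ integrandAddRel ∪
          {x | ∃ (n : ℕ) (r r' : IntegralRep (n + 1)) (Φ : (Fin (n + 1) → ℝ) → (Fin (n + 1) → ℝ))
              (Φ' : (Fin (n + 1) → ℝ) → (Fin (n + 1) → ℝ) →L[ℝ] (Fin (n + 1) → ℝ)),
            IsSemialgebraicMapOn ℚ r.domain Φ ∧
            (∀ x ∈ r.domain, HasFDerivWithinAt Φ (Φ' x) r.domain x) ∧ Set.InjOn Φ r.domain ∧
            r'.domain = Φ '' r.domain ∧
            (∀ x ∈ r.domain, r.integrand x = r'.integrand (Φ x) * |(Φ' x).det|) ∧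
            (∀ x ∈ r.domain, Φ x 0 ∈ Set.Ioo (-1/2 : ℝ) (1/2) ↔ x 0 ∈ Set.Ioo (-1/2 : ℝ) (1/2)) ∧
            x = of r - of r'} ∪
          fibredNewtonLeibnizRel) →
        c ∈ relations :=
  sideDescent (Set.Ioo (-1/2 : ℝ) (1/2)) isSemialgebraic_setOf_apply_zero_mem_band
    (DS := piRep.restrict (piDisc ∩ {z | z 0 ∈ Set.Ioo (-1/2 : ℝ) (1/2)})
      (isSemialgebraic_piDisc.inter (isSemialgebraic_setOf_apply_zero_mem_band 1)) inter_subset_left)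
    rfl rfl
    (stub_sideFinishBand stub_sideMirror _ rfl rfl)

/-- **`π`-cancellation for certificates respecting the left quarter band `(-1/2, 0)`.** [folklore] -/
theorem side_ayoubPiCancellation_quarterL :
    ∀ (P : ∀ n : ℕ, IntegralRep n → IntegralRep (n + 2)),
      (∀ (n : ℕ) (r : IntegralRep n), (P n r).domain = {z : Fin (n + 2) → ℝ | z 0 ^ 2 + z 1 ^ 2 ≤ 1 ∧ (fun i : Fin n => z i.succ.succ) ∈ r.domain} ∧ (P n r).integrand = fun z => r.integrand (fun i : Fin n => z i.succ.succ)) →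
      ∀ c : FormalRep,
        FreeAbelianGroup.lift (fun s : (Σ n, IntegralRep n) => of (P s.1 s.2)) c ∈
          AddSubgroup.closure (domainAddRel ∪ integrandAddRel ∪
          {x | ∃ (n : ℕ) (r r' : IntegralRep (n + 1)) (Φ : (Fin (n + 1) → ℝ) → (Fin (n + 1) → ℝ))
              (Φ' : (Fin (n + 1) → ℝ) → (Fin (n + 1) → ℝ) →L[ℝ] (Fin (n + 1) → ℝ)),
            IsSemialgebraicMapOn ℚ r.domain Φ ∧
            (∀ x ∈ r.domain, HasFDerivWithinAt Φ (Φ' x) r.domain x) ∧ Set.InjOn Φ r.domain ∧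
            r'.domain = Φ '' r.domain ∧
            (∀ x ∈ r.domain, r.integrand x = r'.integrand (Φ x) * |(Φ' x).det|) ∧
            (∀ x ∈ r.domain, Φ x 0 ∈ Set.Ioo (-1/2 : ℝ) 0 ↔ x 0 ∈ Set.Ioo (-1/2 : ℝ) 0) ∧
            x = of r - of r'} ∪
          fibredNewtonLeibnizRel) →
        c ∈ relations :=
  sideDescent (Set.Ioo (-1/2 : ℝ) 0) isSemialgebraic_setOf_apply_zero_mem_quarterL
    (DS := piRep.restrict (piDisc ∩ {z | z 0 ∈ Set.Ioo (-1/2 : ℝ) 0})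
      (isSemialgebraic_piDisc.inter (isSemialgebraic_setOf_apply_zero_mem_quarterL 1)) inter_subset_left)
    rfl rfl
    (stub_sideFinishQuarter stub_sideMirror _ rfl rfl)

/-- **`π`-cancellation for certificates respecting the right quarter band `(0, 1/2)`.** [folklore] -/
theorem side_ayoubPiCancellation_quarterR :
    ∀ (P : ∀ n : ℕ, IntegralRep n → IntegralRep (n + 2)),
      (∀ (n : ℕ) (r : IntegralRep n), (P n r).domain = {z : Fin (n + 2) → ℝ | z 0 ^ 2 + z 1 ^ 2 ≤ 1 ∧ (fun i : Fin n => z i.succ.succ) ∈ r.domain} ∧ (P n r).integrand = fun z => r.integrand (fun i : Fin n => z i.succ.succ)) →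
      ∀ c : FormalRep,
        FreeAbelianGroup.lift (fun s : (Σ n, IntegralRep n) => of (P s.1 s.2)) c ∈
          AddSubgroup.closure (domainAddRel ∪ integrandAddRel ∪
          {x | ∃ (n : ℕ) (r r' : IntegralRep (n + 1)) (Φ : (Fin (n + 1) → ℝ) → (Fin (n + 1) → ℝ))
              (Φ' : (Fin (n + 1) → ℝ) → (Fin (n + 1) → ℝ) →L[ℝ] (Fin (n + 1) → ℝ)),
            IsSemialgebraicMapOn ℚ r.domain Φ ∧
            (∀ x ∈ r.domain, HasFDerivWithinAt Φ (Φ' x) r.domain x) ∧ Set.InjOn Φ r.domain ∧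
            r'.domain = Φ '' r.domain ∧
            (∀ x ∈ r.domain, r.integrand x = r'.integrand (Φ x) * |(Φ' x).det|) ∧
            (∀ x ∈ r.domain, Φ x 0 ∈ Set.Ioo (0 : ℝ) (1/2) ↔ x 0 ∈ Set.Ioo (0 : ℝ) (1/2)) ∧
            x = of r - of r'} ∪
          fibredNewtonLeibnizRel) →
        c ∈ relations :=
  sideDescent (Set.Ioo (0 : ℝ) (1/2)) isSemialgebraic_setOf_apply_zero_mem_quarterR
    (DS := piRep.restrict (piDisc ∩ {z | z 0 ∈ Set.Ioo (0 : ℝ) (1/2)})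
      (isSemialgebraic_piDisc.inter (isSemialgebraic_setOf_apply_zero_mem_quarterR 1)) inter_subset_left)
    rfl rfl
    (finish_quarterR rfl rfl
      (DL := piRep.restrict (piDisc ∩ {z | z 0 ∈ Set.Ioo (-1/2 : ℝ) 0})
        (isSemialgebraic_piDisc.inter (isSemialgebraic_setOf_apply_zero_mem_quarterL 1)) inter_subset_left)
      rfl rfl)

end Summit.KontsevichZagierPeriods.KontsevichZagierPeriods.BetaCancellationLine
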